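import Summits.ValiantsHypothesis.ValiantsHypothesis.Theorems.KPlusLogSqLawTropicalBKroneckerAveraging
import Summits.ValiantsHypothesis.ValiantsHypothesis.Theorems.LacunarySymmetroidMatrixDescartesCensusTropicalKLawStatic
import Summits.ValiantsHypothesis.ValiantsHypothesis.Theorems.KPlusLogSqLawTropicalBAtomBudget

/-!
# Route «KPlusLogSqLaw», crux `TropicalB` (stmt-ValiantsHypothesis-19771) — KRONECKER PRODUCTS OF DESIGNS, part 2: PRODUCTS ARE ADDITIVE;
# the unique optima of a product design are the Kronecker products of the unique optima of its factors at the same slope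

HONEST FRAMING.  Helper toward the registered stub `stub_tropThin` (⟺ `TropicalB`, OPEN) of `Cruxes/TropicalB/Lines/birth.lean`
(crux `Summit.ValiantsHypothesis.ValiantsHypothesis.Theses.KPlusLogSqLaw.TropicalB`, item `stmt-ValiantsHypothesis-19771`, route
`KPlusLogSqLaw`; cell `pub-symmetroid`, seat val-sym-trop-p1 g13, 2026-08-27; `--supports … --as helper`).  A STRUCTURE law about a
CONSTRUCTION (Kronecker/tensor products of dominance designs), valid at every format with no hypothesis on exponents, valuations or signs;
it closes a construction avenue on the refutation side and bounds nothing for general designs.  Nothing here bears on `TropicalB` in its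
window, `WeakLifting`, DoorA26 / DoorA34, `MatrixDescartes` (stmt-ValiantsHypothesis-18050) or VP ≠ VNP.

THE PRODUCT.  Factors `(d₁, v₁, ε₁)` of format `(m₁, K₁)` and `(d₂, v₂, ε₂)` of format `(m₂, K₂)`; the product design `(d, v, ε)` of
format `(m, K)` is given through ANY identifications `e : Fin m₁ × Fin m₂ ≃ Fin m`, `e' : Fin K₁ × Fin K₂ ≃ Fin K` (e.g. `finProdFinEquiv`)
by ADDITIVE exponents and valuations and MULTIPLICATIVE signs:
`d (e'(l₁,l₂)) = d₁ l₁ + d₂ l₂`, `v (e(r₁,r₂)) (e(c₁,c₂)) (e'(l₁,l₂)) = v₁ r₁ c₁ l₁ + v₂ r₂ c₂ l₂`, `ε (…) = ε₁ r₁ c₁ l₁ · ε₂ r₂ c₂ l₂`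
— the dominance design of the Kronecker product of two patchworked pencils `Σ x^{d₁} T¹ ⊗ Σ x^{d₂} T²` read with `K₁K₂` classes.
A general Leibniz term of the product is NOT a product of terms (`(m₁m₂)!` permutations against `m₁!·m₂!`).

* (part 1, `…TropicalBKroneckerAveraging`: `exists_perm_avg` BIRKHOFF AVERAGING and `factor_bound` — the factor-1 part of the weight
  of ANY present product term is at most `m₂ ·` (weight of a present factor term); `card_changes_le`.)
* `tropWeight_product`, `tropWeight_kron`, `termSign_kron_ne_zero` — bookkeeping: the weight splits over the factors; the Kronecker
  term `p₁ ⊗ p₂` (column `e(c₁,c₂)` ↦ row `e(σ₁c₁, σ₂c₂)`, class `e'(λ₁c₁, λ₂c₂)`) weighs `m₂·w(p₁) + m₁·w(p₂)` and is present.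
* `isDominant_product` — **THE LAW**: if a term `P` of the product is the unique optimum at the integer slope `θ` (and `m₁, m₂ ≥ 1`), then
  both factors have unique optima `p₁`, `p₂` at `θ` and `P = p₁ ⊗ p₂`.
* `designRowD_product` — **ADDITIVITY**: `DesignRowD d₁ v₁ ε₁ B₁ → DesignRowD d₂ v₂ ε₂ B₂ → DesignRowD d v ε (B₁ + B₂)`: every dominant
  chain of the product (distinct consecutive terms) has at most `B₁ + B₂` steps — both factors are driven by the SAME slope, each factor
  moves along its own chain of unique optima (`card_changes_le`, via the tree's `card_dominant_le_succ`), and a product step moves a factor.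
READING.  Like direct sums (…TropicalBConcatenation) and symmetric tori (…TropicalBSymmetryTorus), Kronecker products with separable
cell data cannot multiply chain lengths: tensoring the counting-tight `(3,4)`/`(4,4)` designs gives `B₁ + B₂`, not `(B₁+1)(B₂+1) − 1`.
Any register coupling must therefore be non-separable in the cell data.  [Birkhoff–von Neumann: folklore; the packaging is the cell's]
-/

set_option linter.dupNamespace false
set_option autoImplicit false

namespace Summit.ValiantsHypothesis.ValiantsHypothesis.Theorems.KPlusLogSqLaw.Kronecker

open Summit.ValiantsHypothesis.ValiantsHypothesis.Theorems.MatrixDescartes.Negative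
open scoped BigOperators
open Finset

open Summit.ValiantsHypothesis.ValiantsHypothesis.Theorems.LacunarySymmetroidMatrixDescartes.TropicalCensus

section Product

variable {m₁ m₂ K₁ K₂ m K : ℕ}
variable (e : Fin m₁ × Fin m₂ ≃ Fin m) (e' : Fin K₁ × Fin K₂ ≃ Fin K)
variable (d₁ : Fin K₁ → ℕ) (v₁ ε₁ : Fin m₁ → Fin m₁ → Fin K₁ → ℤ)
variable (d₂ : Fin K₂ → ℕ) (v₂ ε₂ : Fin m₂ → Fin m₂ → Fin K₂ → ℤ)
variable (d : Fin K → ℕ) (v ε : Fin m → Fin m → Fin K → ℤ)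

/-- **weight of a term of the product, split along the factors.**  With `ρ x = e⁻¹(π(e x))`, `μ x = e'⁻¹(λ(e x))`:
`w_θ(π, λ) = Σ_x (θ d₁(μ x)₁ − v₁((ρ x)₁, x₁, (μ x)₁)) + Σ_x (θ d₂(μ x)₂ − v₂((ρ x)₂, x₂, (μ x)₂))`. [this cell] -/
theorem tropWeight_product
    (hd : ∀ l₁ l₂, d (e' (l₁, l₂)) = d₁ l₁ + d₂ l₂)
    (hv : ∀ r₁ r₂ c₁ c₂ l₁ l₂, v (e (r₁, r₂)) (e (c₁, c₂)) (e' (l₁, l₂)) = v₁ r₁ c₁ l₁ + v₂ r₂ c₂ l₂)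
    (θ : ℤ) (P : Equiv.Perm (Fin m) × (Fin m → Fin K)) :
    tropWeight d v θ P =
      ∑ x : Fin m₁ × Fin m₂, (θ * (d₁ (e'.symm (P.2 (e x))).1 : ℤ) -
          v₁ (e.symm (P.1 (e x))).1 x.1 (e'.symm (P.2 (e x))).1) +
      ∑ x : Fin m₁ × Fin m₂, (θ * (d₂ (e'.symm (P.2 (e x))).2 : ℤ) -
          v₂ (e.symm (P.1 (e x))).2 x.2 (e'.symm (P.2 (e x))).2) := by
  unfold tropWeight
  rw [← Equiv.sum_comp e (fun c => (d (P.2 c) : ℤ)), ← Equiv.sum_comp e (fun c => v (P.1 c) c (P.2 c)),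
    Finset.mul_sum, ← Finset.sum_sub_distrib, ← Finset.sum_add_distrib]
  refine sum_congr rfl fun x _ => ?_
  have h1 : (d (P.2 (e x)) : ℤ) = d₁ (e'.symm (P.2 (e x))).1 + d₂ (e'.symm (P.2 (e x))).2 := by
    have := hd (e'.symm (P.2 (e x))).1 (e'.symm (P.2 (e x))).2
    rw [Prod.mk.eta, Equiv.apply_symm_apply] at this
    exact_mod_cast this
  have h2 : v (P.1 (e x)) (e x) (P.2 (e x)) =
      v₁ (e.symm (P.1 (e x))).1 x.1 (e'.symm (P.2 (e x))).1 + v₂ (e.symm (P.1 (e x))).2 x.2 (e'.symm (P.2 (e x))).2 := by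
    have := hv (e.symm (P.1 (e x))).1 (e.symm (P.1 (e x))).2 x.1 x.2 (e'.symm (P.2 (e x))).1 (e'.symm (P.2 (e x))).2
    rw [Prod.mk.eta, Prod.mk.eta, Prod.mk.eta, Equiv.apply_symm_apply, Equiv.apply_symm_apply] at this
    exact this
  rw [h1, h2]
  ring

/-- **presence splits along the factors.** [this cell] -/
theorem present_factors
    (hε : ∀ r₁ r₂ c₁ c₂ l₁ l₂, ε (e (r₁, r₂)) (e (c₁, c₂)) (e' (l₁, l₂)) = ε₁ r₁ c₁ l₁ * ε₂ r₂ c₂ l₂)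
    (P : Equiv.Perm (Fin m) × (Fin m → Fin K)) (hP : termSign ε P ≠ 0) (x : Fin m₁ × Fin m₂) :
    ε₁ (e.symm (P.1 (e x))).1 x.1 (e'.symm (P.2 (e x))).1 ≠ 0 ∧
      ε₂ (e.symm (P.1 (e x))).2 x.2 (e'.symm (P.2 (e x))).2 ≠ 0 := by
  have h := present_of_termSign_ne_zero ε P hP (e x)
  have := hε (e.symm (P.1 (e x))).1 (e.symm (P.1 (e x))).2 x.1 x.2 (e'.symm (P.2 (e x))).1 (e'.symm (P.2 (e x))).2
  rw [Prod.mk.eta, Prod.mk.eta, Prod.mk.eta, Equiv.apply_symm_apply, Equiv.apply_symm_apply] at this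
  rw [this] at h
  exact mul_ne_zero_iff.mp h


/-- the factor weights as column sums. [folklore] -/
theorem tropWeight_eq_sum_cols {m₀ K₀ : ℕ} (d₀ : Fin K₀ → ℕ) (v₀ : Fin m₀ → Fin m₀ → Fin K₀ → ℤ) (θ : ℤ)
    (q : Equiv.Perm (Fin m₀) × (Fin m₀ → Fin K₀)) :
    tropWeight d₀ v₀ θ q = ∑ c, (θ * (d₀ (q.2 c) : ℤ) - v₀ (q.1 c) c (q.2 c)) := by
  unfold tropWeight
  rw [Finset.mul_sum, ← Finset.sum_sub_distrib]

/-- **the KRONECKER TERM** `p₁ ⊗ p₂` (column `e(c₁,c₂)` ↦ row `e(σ₁ c₁, σ₂ c₂)`, class `e'(λ₁ c₁, λ₂ c₂)`): its values. [this cell] -/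
theorem kron_apply (p₁ : Equiv.Perm (Fin m₁) × (Fin m₁ → Fin K₁)) (p₂ : Equiv.Perm (Fin m₂) × (Fin m₂ → Fin K₂))
    (x : Fin m₁ × Fin m₂) :
    (e.symm.trans ((Equiv.prodCongr p₁.1 p₂.1).trans e)) (e x) = e (p₁.1 x.1, p₂.1 x.2) ∧
      (fun c => e' (p₁.2 (e.symm c).1, p₂.2 (e.symm c).2)) (e x) = e' (p₁.2 x.1, p₂.2 x.2) := by
  constructor
  · simp only [Equiv.trans_apply, Equiv.symm_apply_apply, Equiv.prodCongr_apply, Prod.map]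
  · simp only [Equiv.symm_apply_apply]

/-- weight of the Kronecker term: `|Fin m₂|·w(p₁) + |Fin m₁|·w(p₂)`. [this cell] -/
theorem tropWeight_kron
    (hd : ∀ l₁ l₂, d (e' (l₁, l₂)) = d₁ l₁ + d₂ l₂)
    (hv : ∀ r₁ r₂ c₁ c₂ l₁ l₂, v (e (r₁, r₂)) (e (c₁, c₂)) (e' (l₁, l₂)) = v₁ r₁ c₁ l₁ + v₂ r₂ c₂ l₂)
    (θ : ℤ) (p₁ : Equiv.Perm (Fin m₁) × (Fin m₁ → Fin K₁)) (p₂ : Equiv.Perm (Fin m₂) × (Fin m₂ → Fin K₂)) :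
    tropWeight d v θ (e.symm.trans ((Equiv.prodCongr p₁.1 p₂.1).trans e),
        fun c => e' (p₁.2 (e.symm c).1, p₂.2 (e.symm c).2)) =
      (Fintype.card (Fin m₂) : ℤ) * tropWeight d₁ v₁ θ p₁ + (Fintype.card (Fin m₁) : ℤ) * tropWeight d₂ v₂ θ p₂ := by
  rw [tropWeight_product e e' d₁ v₁ d₂ v₂ d v hd hv]
  have h1 : ∀ x : Fin m₁ × Fin m₂,
      e.symm ((e.symm.trans ((Equiv.prodCongr p₁.1 p₂.1).trans e)) (e x)) = (p₁.1 x.1, p₂.1 x.2) := by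
    intro x
    rw [(kron_apply e e' p₁ p₂ x).1, Equiv.symm_apply_apply]
  have h2 : ∀ x : Fin m₁ × Fin m₂,
      e'.symm ((fun c => e' (p₁.2 (e.symm c).1, p₂.2 (e.symm c).2)) (e x)) = (p₁.2 x.1, p₂.2 x.2) := by
    intro x
    simp only [Equiv.symm_apply_apply]
  simp only [h1, h2]
  rw [tropWeight_eq_sum_cols d₁ v₁, tropWeight_eq_sum_cols d₂ v₂, Fintype.sum_prod_type, Fintype.sum_prod_type_right,
    Finset.mul_sum, Finset.mul_sum]
  congr 1
  · refine sum_congr rfl fun c₁ _ => ?_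
    simp only [Finset.sum_const, card_univ, nsmul_eq_mul]
  · refine sum_congr rfl fun c₂ _ => ?_
    simp only [Finset.sum_const, card_univ, nsmul_eq_mul]

/-- the Kronecker term of two present terms is present. [this cell] -/
theorem termSign_kron_ne_zero
    (hε : ∀ r₁ r₂ c₁ c₂ l₁ l₂, ε (e (r₁, r₂)) (e (c₁, c₂)) (e' (l₁, l₂)) = ε₁ r₁ c₁ l₁ * ε₂ r₂ c₂ l₂)
    (p₁ : Equiv.Perm (Fin m₁) × (Fin m₁ → Fin K₁)) (p₂ : Equiv.Perm (Fin m₂) × (Fin m₂ → Fin K₂))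
    (h₁ : termSign ε₁ p₁ ≠ 0) (h₂ : termSign ε₂ p₂ ≠ 0) :
    termSign ε (e.symm.trans ((Equiv.prodCongr p₁.1 p₂.1).trans e),
        fun c => e' (p₁.2 (e.symm c).1, p₂.2 (e.symm c).2)) ≠ 0 := by
  refine AtomBudget.termSign_ne_zero_of_cells ε _ fun b => ?_
  obtain ⟨x, rfl⟩ := e.surjective b
  have hk := kron_apply e e' p₁ p₂ x
  simp only at hk ⊢
  rw [hk.1, hk.2]
  have hx : e x = e (x.1, x.2) := rfl
  rw [hx, hε]
  exact mul_ne_zero (present_of_termSign_ne_zero ε₁ p₁ h₁ x.1) (present_of_termSign_ne_zero ε₂ p₂ h₂ x.2)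

/-- **DOMINANT TERMS OF A KRONECKER PRODUCT ARE KRONECKER TERMS.**  In the product design (exponents and valuations ADD over the two
factors, signs multiply; rows/columns and classes of the product identified with pairs by `e`, `e'`), a term that is the unique
tropical optimum at a slope `θ` is the Kronecker product `p₁ ⊗ p₂` of the unique optima `p₁`, `p₂` of the two factors at the SAME slope
`θ` (which therefore exist).  Birkhoff averaging: the factor-1 footprint of any product term is `m₂` times a doubly stochastic pattern,
so its weight is at most `m₂·w(p₁) + m₁·w(p₂) = w(p₁ ⊗ p₂)`. [this cell] -/
theorem isDominant_product
    (hd : ∀ l₁ l₂, d (e' (l₁, l₂)) = d₁ l₁ + d₂ l₂)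
    (hv : ∀ r₁ r₂ c₁ c₂ l₁ l₂, v (e (r₁, r₂)) (e (c₁, c₂)) (e' (l₁, l₂)) = v₁ r₁ c₁ l₁ + v₂ r₂ c₂ l₂)
    (hε : ∀ r₁ r₂ c₁ c₂ l₁ l₂, ε (e (r₁, r₂)) (e (c₁, c₂)) (e' (l₁, l₂)) = ε₁ r₁ c₁ l₁ * ε₂ r₂ c₂ l₂)
    (hm₁ : 0 < m₁) (hm₂ : 0 < m₂) {θ : ℤ} {P : Equiv.Perm (Fin m) × (Fin m → Fin K)} (hP : IsDominant d v ε θ P) :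
    ∃ (p₁ : Equiv.Perm (Fin m₁) × (Fin m₁ → Fin K₁)) (p₂ : Equiv.Perm (Fin m₂) × (Fin m₂ → Fin K₂)),
      IsDominant d₁ v₁ ε₁ θ p₁ ∧ IsDominant d₂ v₂ ε₂ θ p₂ ∧
      ∀ x : Fin m₁ × Fin m₂, P.1 (e x) = e (p₁.1 x.1, p₂.1 x.2) ∧ P.2 (e x) = e' (p₁.2 x.1, p₂.2 x.2) := by
  classical
  have hβ₂ : 0 < Fintype.card (Fin m₂) := by rwa [Fintype.card_fin]
  have hβ₁ : 0 < Fintype.card (Fin m₁) := by rwa [Fintype.card_fin]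
  -- the quotient bijection of the product columns
  let ρE : Fin m₁ × Fin m₂ ≃ Fin m₁ × Fin m₂ := e.trans (P.1.trans e.symm)
  have hρE : ∀ x, ρE x = e.symm (P.1 (e x)) := fun x => rfl
  have hpres := present_factors e e' ε₁ ε₂ ε hε P hP.1
  -- factor 1
  obtain ⟨q₁, hq₁, hle₁⟩ := factor_bound d₁ v₁ ε₁ θ hβ₂ (fun x : Fin m₁ × Fin m₂ => (e.symm (P.1 (e x))).1)
    (fun x => (e'.symm (P.2 (e x))).1)
    (fun r => by
      have := card_filter_fst_comp_equiv ρE r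
      simpa only [hρE] using this)
    (fun x => (hpres x).1)
  -- factor 2 (coordinates swapped)
  let ρE' : Fin m₂ × Fin m₁ ≃ Fin m₂ × Fin m₁ := (Equiv.prodComm (Fin m₂) (Fin m₁)).trans (ρE.trans (Equiv.prodComm _ _))
  have hρE' : ∀ y : Fin m₂ × Fin m₁, (ρE' y).1 = (e.symm (P.1 (e (y.2, y.1)))).2 := fun y => rfl
  obtain ⟨q₂, hq₂, hle₂⟩ := factor_bound d₂ v₂ ε₂ θ hβ₁ (fun y : Fin m₂ × Fin m₁ => (e.symm (P.1 (e (y.2, y.1)))).2)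
    (fun y => (e'.symm (P.2 (e (y.2, y.1)))).2)
    (fun r => by
      have := card_filter_fst_comp_equiv ρE' r
      simpa only [hρE'] using this)
    (fun y => (hpres (y.2, y.1)).2)
  have hle₂' : ∑ x : Fin m₁ × Fin m₂, (θ * (d₂ (e'.symm (P.2 (e x))).2 : ℤ) -
      v₂ (e.symm (P.1 (e x))).2 x.2 (e'.symm (P.2 (e x))).2) ≤ (Fintype.card (Fin m₁) : ℤ) * tropWeight d₂ v₂ θ q₂ := by
    rw [← Equiv.sum_comp (Equiv.prodComm (Fin m₂) (Fin m₁))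
      (fun x : Fin m₁ × Fin m₂ => (θ * (d₂ (e'.symm (P.2 (e x))).2 : ℤ) - v₂ (e.symm (P.1 (e x))).2 x.2 (e'.symm (P.2 (e x))).2))]
    simpa only [Equiv.prodComm_apply, Prod.swap] using hle₂
  -- maximisers over the present terms of the factors
  obtain ⟨p₁, hp₁D, hp₁max⟩ := Finset.exists_max_image (univ.filter fun q => termSign ε₁ q ≠ 0) (tropWeight d₁ v₁ θ)
    ⟨q₁, mem_filter.mpr ⟨mem_univ _, hq₁⟩⟩
  obtain ⟨p₂, hp₂D, hp₂max⟩ := Finset.exists_max_image (univ.filter fun q => termSign ε₂ q ≠ 0) (tropWeight d₂ v₂ θ)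
    ⟨q₂, mem_filter.mpr ⟨mem_univ _, hq₂⟩⟩
  have hp₁ : termSign ε₁ p₁ ≠ 0 := (mem_filter.mp hp₁D).2
  have hp₂ : termSign ε₂ p₂ ≠ 0 := (mem_filter.mp hp₂D).2
  -- KEY: `P` is the Kronecker term of ANY pair of maximisers
  have key : ∀ (a₁ : Equiv.Perm (Fin m₁) × (Fin m₁ → Fin K₁)) (a₂ : Equiv.Perm (Fin m₂) × (Fin m₂ → Fin K₂)),
      termSign ε₁ a₁ ≠ 0 → termSign ε₂ a₂ ≠ 0 →
      (∀ q, termSign ε₁ q ≠ 0 → tropWeight d₁ v₁ θ q ≤ tropWeight d₁ v₁ θ a₁) →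
      (∀ q, termSign ε₂ q ≠ 0 → tropWeight d₂ v₂ θ q ≤ tropWeight d₂ v₂ θ a₂) →
      P = (e.symm.trans ((Equiv.prodCongr a₁.1 a₂.1).trans e), fun c => e' (a₁.2 (e.symm c).1, a₂.2 (e.symm c).2)) := by
    intro a₁ a₂ ha₁ ha₂ hmax₁ hmax₂
    have hwt : tropWeight d v θ P ≤ tropWeight d v θ
        (e.symm.trans ((Equiv.prodCongr a₁.1 a₂.1).trans e), fun c => e' (a₁.2 (e.symm c).1, a₂.2 (e.symm c).2)) := by
      rw [tropWeight_kron e e' d₁ v₁ d₂ v₂ d v hd hv, tropWeight_product e e' d₁ v₁ d₂ v₂ d v hd hv θ P]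
      have i1 := mul_le_mul_of_nonneg_left (hmax₁ q₁ hq₁) (show (0 : ℤ) ≤ Fintype.card (Fin m₂) by positivity)
      have i2 := mul_le_mul_of_nonneg_left (hmax₂ q₂ hq₂) (show (0 : ℤ) ≤ Fintype.card (Fin m₁) by positivity)
      linarith
    by_contra hne
    have hlt := hP.2 _ (Ne.symm hne) (termSign_kron_ne_zero e e' ε₁ ε₂ ε hε a₁ a₂ ha₁ ha₂)
    exact absurd hwt (not_le.mpr hlt)
  have hmax₁ : ∀ q, termSign ε₁ q ≠ 0 → tropWeight d₁ v₁ θ q ≤ tropWeight d₁ v₁ θ p₁ :=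
    fun q hq => hp₁max q (mem_filter.mpr ⟨mem_univ _, hq⟩)
  have hmax₂ : ∀ q, termSign ε₂ q ≠ 0 → tropWeight d₂ v₂ θ q ≤ tropWeight d₂ v₂ θ p₂ :=
    fun q hq => hp₂max q (mem_filter.mpr ⟨mem_univ _, hq⟩)
  have hPk := key p₁ p₂ hp₁ hp₂ hmax₁ hmax₂
  -- read off the factors at a product column
  have hread : ∀ (a₁ : Equiv.Perm (Fin m₁) × (Fin m₁ → Fin K₁)) (a₂ : Equiv.Perm (Fin m₂) × (Fin m₂ → Fin K₂)),
      P = (e.symm.trans ((Equiv.prodCongr a₁.1 a₂.1).trans e), fun c => e' (a₁.2 (e.symm c).1, a₂.2 (e.symm c).2)) →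
      ∀ x : Fin m₁ × Fin m₂, P.1 (e x) = e (a₁.1 x.1, a₂.1 x.2) ∧ P.2 (e x) = e' (a₁.2 x.1, a₂.2 x.2) := by
    intro a₁ a₂ h x
    rw [h]
    exact kron_apply e e' a₁ a₂ x
  refine ⟨p₁, p₂, ⟨hp₁, fun q hqne hq => ?_⟩, ⟨hp₂, fun q hqne hq => ?_⟩, hread p₁ p₂ hPk⟩
  · -- uniqueness in factor 1
    refine lt_of_le_of_ne (hmax₁ q hq) fun heq => hqne ?_
    have hmaxq : ∀ q', termSign ε₁ q' ≠ 0 → tropWeight d₁ v₁ θ q' ≤ tropWeight d₁ v₁ θ q :=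
      fun q' hq' => heq ▸ hmax₁ q' hq'
    have hQ := hread q p₂ (key q p₂ hq hp₂ hmaxq hmax₂)
    have hPr := hread p₁ p₂ hPk
    refine Prod.ext (Equiv.ext fun c₁ => ?_) (funext fun c₁ => ?_)
    · have a := (hQ (c₁, ⟨0, hm₂⟩)).1
      rw [(hPr (c₁, ⟨0, hm₂⟩)).1] at a
      exact (Prod.ext_iff.mp (e.injective a)).1.symm
    · have a := (hQ (c₁, ⟨0, hm₂⟩)).2
      rw [(hPr (c₁, ⟨0, hm₂⟩)).2] at a
      exact (Prod.ext_iff.mp (e'.injective a)).1.symm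
  · -- uniqueness in factor 2
    refine lt_of_le_of_ne (hmax₂ q hq) fun heq => hqne ?_
    have hmaxq : ∀ q', termSign ε₂ q' ≠ 0 → tropWeight d₂ v₂ θ q' ≤ tropWeight d₂ v₂ θ q :=
      fun q' hq' => heq ▸ hmax₂ q' hq'
    have hQ := hread p₁ q (key p₁ q hp₁ hq hmax₁ hmaxq)
    have hPr := hread p₁ p₂ hPk
    refine Prod.ext (Equiv.ext fun c₂ => ?_) (funext fun c₂ => ?_)
    · have a := (hQ (⟨0, hm₁⟩, c₂)).1
      rw [(hPr (⟨0, hm₁⟩, c₂)).1] at a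
      exact (Prod.ext_iff.mp (e.injective a)).2.symm
    · have a := (hQ (⟨0, hm₁⟩, c₂)).2
      rw [(hPr (⟨0, hm₁⟩, c₂)).2] at a
      exact (Prod.ext_iff.mp (e'.injective a)).2.symm


/-- **KRONECKER PRODUCTS ARE ADDITIVE.**  If every dominant chain (distinct consecutive terms) of the first factor has at most `B₁`
steps and of the second at most `B₂`, then every dominant chain of the Kronecker product has at most `B₁ + B₂` steps: both factors are
driven by the SAME slope parameter, and a step of the product changes at least one factor.  In particular tensoring counting-tight small
designs never multiplies chain lengths. [this cell] -/
theorem designRowD_product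
    (hd : ∀ l₁ l₂, d (e' (l₁, l₂)) = d₁ l₁ + d₂ l₂)
    (hv : ∀ r₁ r₂ c₁ c₂ l₁ l₂, v (e (r₁, r₂)) (e (c₁, c₂)) (e' (l₁, l₂)) = v₁ r₁ c₁ l₁ + v₂ r₂ c₂ l₂)
    (hε : ∀ r₁ r₂ c₁ c₂ l₁ l₂, ε (e (r₁, r₂)) (e (c₁, c₂)) (e' (l₁, l₂)) = ε₁ r₁ c₁ l₁ * ε₂ r₂ c₂ l₂)
    (hm₁ : 0 < m₁) (hm₂ : 0 < m₂) {B₁ B₂ : ℕ} (h₁ : DesignRowD d₁ v₁ ε₁ B₁) (h₂ : DesignRowD d₂ v₂ ε₂ B₂) :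
    DesignRowD d v ε (B₁ + B₂) := by
  classical
  intro n θ P hθ hdom hne
  have hfac : ∀ k, ∃ (p₁ : Equiv.Perm (Fin m₁) × (Fin m₁ → Fin K₁)) (p₂ : Equiv.Perm (Fin m₂) × (Fin m₂ → Fin K₂)),
      IsDominant d₁ v₁ ε₁ (θ k) p₁ ∧ IsDominant d₂ v₂ ε₂ (θ k) p₂ ∧
      ∀ x : Fin m₁ × Fin m₂, (P k).1 (e x) = e (p₁.1 x.1, p₂.1 x.2) ∧ (P k).2 (e x) = e' (p₁.2 x.1, p₂.2 x.2) :=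
    fun k => isDominant_product e e' d₁ v₁ ε₁ d₂ v₂ ε₂ d v ε hd hv hε hm₁ hm₂ (hdom k)
  choose p₁ p₂ hp₁ hp₂ hP using hfac
  -- every step of the product changes a factor
  have hstep : ∀ k : Fin n, p₁ k.castSucc ≠ p₁ k.succ ∨ p₂ k.castSucc ≠ p₂ k.succ := by
    intro k
    by_contra h
    push Not at h
    obtain ⟨e1, e2⟩ := h
    apply hne k
    refine Prod.ext (Equiv.ext fun c => ?_) (funext fun c => ?_)
    · obtain ⟨x, rfl⟩ := e.surjective c
      rw [(hP k.castSucc x).1, (hP k.succ x).1, e1, e2]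
    · obtain ⟨x, rfl⟩ := e.surjective c
      rw [(hP k.castSucc x).2, (hP k.succ x).2, e1, e2]
  have hcover : (univ : Finset (Fin n)) ⊆
      (univ.filter fun k : Fin n => p₁ k.castSucc ≠ p₁ k.succ) ∪ (univ.filter fun k : Fin n => p₂ k.castSucc ≠ p₂ k.succ) := by
    intro k _
    rcases hstep k with h | h
    · exact mem_union_left _ (mem_filter.mpr ⟨mem_univ _, h⟩)
    · exact mem_union_right _ (mem_filter.mpr ⟨mem_univ _, h⟩)
  have hJ₁ := card_changes_le d₁ v₁ ε₁ h₁ θ hθ p₁ hp₁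
  have hJ₂ := card_changes_le d₂ v₂ ε₂ h₂ θ hθ p₂ hp₂
  have := (card_le_card hcover).trans (card_union_le _ _)
  rw [card_univ, Fintype.card_fin] at this
  omega

end Product

end Summit.ValiantsHypothesis.ValiantsHypothesis.Theorems.KPlusLogSqLaw.Kronecker
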